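import Mathlib
import HarnessLib
import Summits.HubbardSuperconductivity.HubbardSuperconductivity.Theorems.ComplexGFFStiffnessH1Sigma2Shrink

/-!
# Crux `HypACumulant`, child `F4StatementOfCores` — the mixed `q`/state slot `F4l'` HOLDS for the SHRUNK package,
# `N`-free, GIVEN the two-kernel bound `TwoKernelSkBound` ([ABKM19] Lemma 12.6 (12.53), mixed order, holomorphic route)

Route `route-HubbardSuperconductivity-ComplexGFFStiffness`, crux stmt-HubbardSuperconductivity-19154
(`HypACumulant`), child stmt-…-27379 (`F4StatementOfCores := TwoKernelSkBound 4 → L2GaussianCore 4 → F4Statement 4`,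
residual slots `F4l2`, `F4l'` by `f4StatementOfCores_of_SkSlots`).  The slot `F4l' P Q l_T'` asks that the
`q`-DIFFERENCE `(u, v) ↦ S_{q'}(u, v) − S_q(u, v)` be Lipschitz in the state on the closed Theorem-6.8 ball, with a
constant `∝ |q' − q|₁`.  The `N`-free two-kernel bound `TwoKernelSkBound d` (hypothesis of the child; census (C3c-v))
bounds that difference by `l_T |q' − q|₁ · r` on the ball of radius `r = P.r`; the difference is holomorphic along
complex state lines (`…HolomorphicPackageLines.weakNormLE_sub_nextKStep_pair_package`), so Cauchy's estimate gives the
Lipschitz bound — for states in the ball of radius `P.r/8`, i.e. for the shrunk package (room `R = 7r/8`):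

* **`f4l'_shrink_of_f4l`** — `F4l P Q.unshrink l_T → F4l' P.shrink Q ((r₀+1)·(16/7)·l_T)` at one height;
* **`f4l'_shrink_of_twoKernelSkBound`** — `TwoKernelSkBound d → ∀ P, ∃ l_T' ≥ 0, ∀ N M (Q : PackageAt P.shrink N M),
  F4l' P.shrink Q l_T'`: the shrunk-package form of the `F4l'` half of the child 27379.

All proved, no `sorry`; `TwoKernelSkBound` enters as an explicit hypothesis exactly as in the child's own signature
(nothing is assumed as a named fact).  Honest scope: rung route (stiffness of a complex Gaussian gradient field via
the [ABKM19] RG); nothing about superconductivity in the Hubbard model; the OTHER residual slot `F4l2` (second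
`q`-differences) is NOT touched here (it needs the Banach-grade two-kernel machinery at second order).

## References
* S. Adams, S. Buchholz, R. Kotecký, S. Müller, arXiv:1910.13564, Lemma 12.6 (12.53), Theorem 6.8, Ch. 12 (12.4)
  [AdamsBuchholzKoteckyMuller2019].
-/

noncomputable section

-- `Summit.<Summit>.<Problem>`: single-conjunct summit, the duplicate component is mandated (D-0017).
set_option linter.dupNamespace false

namespace Summit.HubbardSuperconductivity.HubbardSuperconductivity.Theorems.ComplexGFF

open MeasureTheory Metric Set
open scoped BigOperators
open Literature.MathematicalPhysics.StatisticalMechanics.GradientRG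
open Literature.MathematicalPhysics.StatisticalMechanics.TorusPolymer (IsPolymer blockOf)
open Literature.Barriers.CriticalPhenomena.LongRangePhi4.Polymer (IsConn)
open Literature.MathematicalPhysics.StatisticalMechanics

variable {d : ℕ}

set_option maxHeartbeats 1600000 in
/-- **`F4l'` for the shrunk package from `F4l` on the Theorem-6.8 ball of the package** (one height):
`F4l P Q.unshrink l_T → F4l' P.shrink Q ((r₀+1)·(16/7)·l_T)`. -/
theorem f4l'_shrink_of_f4l (P : PackageData d) [Fact (0 < P.h)] [Fact (0 < P.L)] {N M : ℕ} [NeZero M]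
    (Q : PackageAt P.shrink N M) {lT : ℝ} (hlT0 : 0 ≤ lT) (hl : F4l P Q.unshrink lT) :
    F4l' P.shrink Q (((P.r₀ : ℝ) + 1) * (16 / 7) * lT) := by
  intro q q' hq hq' k hk u u' v v' cv cv' cd hu hu' hv hcv hv' hcv' hvv'
  set Q' : PackageAt P N M := Q.unshrink with hQ'
  set lT' := ((P.r₀ : ℝ) + 1) * (16 / 7) * lT with hlT'
  have hlT'0 : 0 ≤ lT' := by positivity
  have hPA : 0 < Q'.normParams.A := P.A_pos
  have hrs : P.shrink.r = P.r / 8 := rfl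
  rw [hrs] at hu hu' hcv hcv'
  have hMt : M = Q'.normParams.L ^ k * P.L ^ (N - k) := by
    show M = P.L ^ k * P.L ^ (N - k)
    rw [Q.hM, ← pow_add, Nat.add_sub_cancel' (by omega)]
  have hQn := isSubaddNormBound_activityNormLE Q'.normParams hPA
  have hcv0 : 0 ≤ cv := nonneg_of_weakNormLE hPA hMt P.hLodd.pow P.hLodd.pow hv
  have hcv'0 : 0 ≤ cv' := nonneg_of_weakNormLE hPA hMt P.hLodd.pow P.hLodd.pow hv'
  have hcd0 : 0 ≤ cd := nonneg_of_weakNormLE hPA hMt P.hLodd.pow P.hLodd.pow hvv'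
  have hes0 : 0 ≤ esum (q' - q) := entrySum_nonneg _
  -- the difference direction and its sizes
  have hnu : ‖u - u'‖ ≤ 2 * (P.r / 8) := (norm_sub_le u u').trans (by linarith)
  have hd2 : activityNormLE Q'.normParams k (v - v') (min cd (2 * (P.r / 8))) := by
    have h1 : activityNormLE Q'.normParams k (v - v') (cv + cv') := by
      have := hQn.add k v (-v') cv cv' hv (hQn.neg k v' cv' hv')
      simpa [sub_eq_add_neg] using this
    exact WeakNormLE.min hPA hvv' (WeakNormLE.mono h1 hPA (by linarith))
  set δ := max ‖u - u'‖ (min cd (2 * (P.r / 8))) with hδ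
  have hcd' : 0 ≤ min cd (2 * (P.r / 8)) := le_min hcd0 (by linarith [P.hr0])
  have hδ0 : 0 ≤ δ := le_max_of_le_left (norm_nonneg _)
  have hδ2 : δ ≤ 2 * (P.r / 8) := max_le hnu (min_le_right _ _)
  have hδA : δ ≤ max ‖u - u'‖ cd := max_le_max le_rfl (min_le_left _ _)
  have hA0 : 0 ≤ max ‖u - u'‖ cd := le_max_of_le_left (norm_nonneg _)
  -- target through the unshrunk realisation
  show activityNormLE Q'.normParams (k + 1)
    ((Q'.opS q' k u v - Q'.opS q k u v) - (Q'.opS q' k u' v' - Q'.opS q k u' v')) (lT' * esum (q' - q) * max ‖u - u'‖ cd)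
  by_cases hr0 : P.r = 0
  · -- degenerate package: both brackets vanish by `F4l` itself
    rw [hr0] at hu hu' hcv hcv'
    have h1 := hl q' q hq' hq k hk u v cv (by linarith [P.hr0]) hv (by linarith [P.hr0])
    have h2 := hl q' q hq' hq k hk u' v' cv' (by linarith [P.hr0]) hv' (by linarith [P.hr0])
    have hm1 : max ‖u‖ cv = 0 := le_antisymm (max_le (by linarith) (by linarith)) (le_max_of_le_left (norm_nonneg _))
    have hm2 : max ‖u'‖ cv' = 0 := le_antisymm (max_le (by linarith) (by linarith)) (le_max_of_le_left (norm_nonneg _))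
    rw [hm1, mul_zero] at h1
    rw [hm2, mul_zero] at h2
    have h := hQn.add (k + 1) _ _ 0 0 h1 (hQn.neg (k + 1) _ 0 h2)
    rw [add_zero, ← sub_eq_add_neg] at h
    exact hQn.mono (k + 1) _ _ _ h (by positivity)
  · have hrpos : 0 < P.r := lt_of_le_of_ne P.hr0 (Ne.symm hr0)
    -- the complex line from `(u', v')` towards `(u, v)`, renormalised by `n = δ + t`
    have hlim : ∀ t, 0 < t → t ≤ P.r / 8 →
        activityNormLE Q'.normParams (k + 1)
          ((Q'.opS q' k u v - Q'.opS q k u v) - (Q'.opS q' k u' v' - Q'.opS q k u' v'))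
          (lT' * esum (q' - q) * (max ‖u - u'‖ cd + t) * (1 + t)) := by
      intro t ht htr
      set n := δ + t with hn
      have hn0 : 0 < n := by linarith
      have hni : 0 ≤ n⁻¹ := inv_nonneg.2 hn0.le
      set R := 7 * P.r / 8 with hRdef
      have hR0 : 0 < R := by positivity
      have hnR : n < R := by linarith
      -- directions
      set w : HamSpace ℂ d (fieldWt P.h (P.L : ℝ) d k) ((P.L : ℝ) ^ k) (P.L ^ (d * k)) := (n⁻¹ : ℝ) • (u - u') with hw
      set w' : activitySpace Q'.normParams k := (n⁻¹ : ℝ) • (v - v') with hw'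
      have hnw : ‖w‖ = n⁻¹ * ‖u - u'‖ := by rw [hw, norm_smul, Real.norm_eq_abs, abs_of_nonneg hni]
      have hw'n : activityNormLE Q'.normParams k w' (n⁻¹ * min cd (2 * (P.r / 8))) := by
        have h := WeakNormLE.smul hd2 (activitySpace.contDiff (v - v')) n⁻¹
        rw [abs_of_nonneg hni] at h
        show WeakNormLE Q'.normParams k ((w' : activitySpace Q'.normParams k) : Finset (Fin d → ZMod M) →
          ((Fin d → ZMod M) → ℝ) → ℂ) (n⁻¹ * min cd (2 * (P.r / 8)))
        rw [hw', Submodule.coe_smul]; exact h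
      have hwq : n⁻¹ * ‖u - u'‖ ≤ 1 := by
        rw [inv_mul_le_iff₀ hn0]; linarith [le_max_left ‖u - u'‖ (min cd (2 * (P.r / 8)))]
      have hw'q : n⁻¹ * min cd (2 * (P.r / 8)) ≤ 1 := by
        rw [inv_mul_le_iff₀ hn0]; linarith [le_max_right ‖u - u'‖ (min cd (2 * (P.r / 8)))]
      set H₀ := HamSpace.toHam u' with hH₀
      set U := HamSpace.toHam w with hU
      set a := ((v' : activitySpace Q'.normParams k) : Finset (Fin d → ZMod M) → ((Fin d → ZMod M) → ℝ) → ℂ) with ha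
      set b := ((w' : activitySpace Q'.normParams k) : Finset (Fin d → ZMod M) → ((Fin d → ZMod M) → ℝ) → ℂ) with hb
      have hHball : hamNorm (fieldWt P.h (P.L : ℝ) d k) ((P.L : ℝ) ^ k) (P.L ^ (d * k)) H₀ +
          R * hamNorm (fieldWt P.h (P.L : ℝ) d k) ((P.L : ℝ) ^ k) (P.L ^ (d * k)) U ≤ P.r := by
        rw [hH₀, hU, hamNorm_toHam_eq, hamNorm_toHam_eq, hnw]
        nlinarith [mul_le_mul_of_nonneg_left hwq hR0.le]
      have hKball : cv' + R * (n⁻¹ * min cd (2 * (P.r / 8))) ≤ P.r := by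
        nlinarith [mul_le_mul_of_nonneg_left hw'q hR0.le]
      -- the uniform bound of the `q`-difference on the disc, from `F4l` on the `P.r`-ball
      have hL0 : (0 : ℝ) < P.L := by exact_mod_cast P.hLodd.pos
      have h𝔥 : 0 ≤ fieldWt P.h (P.L : ℝ) d k := (fieldWt_pos P.hh hL0 d k).le
      have hRk : (0 : ℝ) ≤ (P.L : ℝ) ^ k := by positivity
      have hG : ∀ σ ∈ ball (0 : ℂ) R, WeakNormLE Q'.normParams (k + 1)
          (fun X ψ => nextKStep (abkmStepData P.L P.R k (Q'.kernels q')) (H₀ + σ • U) (mulExt (a + σ • b)) X ψ -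
            nextKStep (abkmStepData P.L P.R k (Q'.kernels q)) (H₀ + σ • U) (mulExt (a + σ • b)) X ψ)
          (lT * esum (q' - q) * P.r) := by
        intro σ hσ
        have hσ' : ‖σ‖ ≤ R := le_of_lt (mem_ball_zero_iff.1 hσ)
        -- the state `(u_σ, v_σ)` as elements
        set uσ : HamSpace ℂ d (fieldWt P.h (P.L : ℝ) d k) ((P.L : ℝ) ^ k) (P.L ^ (d * k)) :=
          HamSpace.toHam.symm (H₀ + σ • U) with huσ
        have htoHam : HamSpace.toHam uσ = H₀ + σ • U := by rw [huσ]; exact LinearEquiv.apply_symm_apply _ _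
        have huσn : ‖uσ‖ ≤ P.r := by
          rw [HamSpace.norm_def, htoHam]
          have h1 := hamNorm_add_le h𝔥 hRk (P.L ^ (d * k)) H₀ (σ • U)
          rw [hamNorm_complex_smul] at h1
          have h2 : 0 ≤ hamNorm (fieldWt P.h (P.L : ℝ) d k) ((P.L : ℝ) ^ k) (P.L ^ (d * k)) U := hamNorm_nonneg h𝔥 hRk _ _
          nlinarith
        have hmem : a + σ • b ∈ activitySpace Q'.normParams k :=
          activitySpace.mem_of (contDiff_lineAct (activitySpace.contDiff v') (activitySpace.contDiff w') σ)
            (fun X hX hXc => isGaugeLocal_lineAct (activitySpace.isGaugeLocal v' hX hXc)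
              (activitySpace.isGaugeLocal w' hX hXc) σ)
            (transInv_lineAct (activitySpace.transInv v') (activitySpace.transInv w') σ)
            (weakNormLE_lineAct hv' hw'n (activitySpace.contDiff v') (activitySpace.contDiff w') σ)
        set vσ : activitySpace Q'.normParams k := ⟨a + σ • b, hmem⟩ with hvσ
        have hvσn : activityNormLE Q'.normParams k vσ (cv' + ‖σ‖ * (n⁻¹ * min cd (2 * (P.r / 8)))) :=
          weakNormLE_lineAct hv' hw'n (activitySpace.contDiff v') (activitySpace.contDiff w') σ
        have hcσ : cv' + ‖σ‖ * (n⁻¹ * min cd (2 * (P.r / 8))) ≤ P.r := by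
          nlinarith [mul_le_mul_of_nonneg_right hσ' (mul_nonneg hni hcd')]
        have hF := hl q' q hq' hq k hk uσ vσ _ huσn hvσn hcσ
        have hmax : max ‖uσ‖ (cv' + ‖σ‖ * (n⁻¹ * min cd (2 * (P.r / 8)))) ≤ P.r := max_le huσn hcσ
        have hF' : activityNormLE Q'.normParams (k + 1) (Q'.opS q' k uσ vσ - Q'.opS q k uσ vσ)
            (lT * esum (q' - q) * P.r) :=
          hQn.mono (k + 1) _ _ _ hF (mul_le_mul_of_nonneg_left hmax (mul_nonneg hlT0 hes0))
        -- identify with the raw difference on connected polymers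
        unfold activityNormLE at hF'
        rw [Submodule.coe_sub, packageAt_coe_opS P Q' hq' hk uσ vσ huσn hvσn hcσ,
          packageAt_coe_opS P Q' hq hk uσ vσ huσn hvσn hcσ, htoHam] at hF'
        intro X hX hXc
        have hXp : IsPolymer (P.L ^ (k + 1)) X := hX
        have h := hF' X hX hXc
        simp only [Pi.sub_apply, restrictConn_of_conn hXp hXc] at h
        exact h
      -- the engine
      have hσ₀ : ((n : ℝ) : ℂ) ∈ ball (0 : ℂ) R := by
        rw [mem_ball_zero_iff, Complex.norm_real, Real.norm_eq_abs, abs_of_pos hn0]; exact hnR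
      have heng := weakNormLE_sub_nextKStep_pair_package P Q' hq hq' hk H₀ U (a := a) (b := b) hcv'0
        (mul_nonneg hni hcd') hv' hw'n (activitySpace.contDiff v') (activitySpace.contDiff w')
        (fun Y hY hYc => activitySpace.isGaugeLocal v' hY hYc) (fun Y hY hYc => activitySpace.isGaugeLocal w' hY hYc)
        hHball hKball hG hσ₀
      -- identify the endpoints
      have eU : ((n : ℝ) : ℂ) • U = HamSpace.toHam (u - u') := by
        rw [hU, hw, map_smul]; exact complex_smul_inv_smul_ham hn0.ne' _
      have eb : ((n : ℝ) : ℂ) • b = ((v - v' : activitySpace Q'.normParams k) : Finset (Fin d → ZMod M) →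
          ((Fin d → ZMod M) → ℝ) → ℂ) := by
        rw [hb, hw', Submodule.coe_smul]; exact complex_smul_inv_smul_act hn0.ne' _
      have eH1 : H₀ + ((n : ℝ) : ℂ) • U = HamSpace.toHam u := by
        rw [eU, hH₀, ← map_add, add_sub_cancel]
      have eH0 : H₀ + (0 : ℂ) • U = HamSpace.toHam u' := by rw [zero_smul, add_zero]
      have eK1 : a + ((n : ℝ) : ℂ) • b = ((v : activitySpace Q'.normParams k) : Finset (Fin d → ZMod M) →
          ((Fin d → ZMod M) → ℝ) → ℂ) := by
        rw [eb, ha, ← Submodule.coe_add, add_sub_cancel]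
      have eK0 : a + (0 : ℂ) • b = ((v' : activitySpace Q'.normParams k) : Finset (Fin d → ZMod M) →
          ((Fin d → ZMod M) → ℝ) → ℂ) := by rw [zero_smul, add_zero]
      have enorm : ((P.r₀ : ℝ) + 1) * (2 * (lT * esum (q' - q) * P.r) / R) * ‖((n : ℝ) : ℂ)‖ =
          lT' * esum (q' - q) * n := by
        rw [Complex.norm_real, Real.norm_eq_abs, abs_of_pos hn0, hlT', hRdef]
        field_simp
        ring
      simp only [eH1, eH0, eK1, eK0, enorm] at heng
      -- back to `opS`
      have hgoal : activityNormLE Q'.normParams (k + 1)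
          ((Q'.opS q' k u v - Q'.opS q k u v) - (Q'.opS q' k u' v' - Q'.opS q k u' v')) (lT' * esum (q' - q) * n) := by
        unfold activityNormLE
        rw [Submodule.coe_sub, Submodule.coe_sub, Submodule.coe_sub,
          packageAt_coe_opS P Q' hq' hk u v (by linarith) hv (by linarith),
          packageAt_coe_opS P Q' hq hk u v (by linarith) hv (by linarith),
          packageAt_coe_opS P Q' hq' hk u' v' (by linarith) hv' (by linarith),
          packageAt_coe_opS P Q' hq hk u' v' (by linarith) hv' (by linarith)]
        intro X hX hXc
        have hXp : IsPolymer (P.L ^ (k + 1)) X := hX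
        simp only [Pi.sub_apply, restrictConn_of_conn hXp hXc]
        exact heng X hX hXc
      refine hQn.mono (k + 1) _ _ _ hgoal ?_
      have h1 : n ≤ max ‖u - u'‖ cd + t := by rw [hn]; linarith
      have h3 : 0 ≤ lT' * esum (q' - q) := mul_nonneg hlT'0 hes0
      calc lT' * esum (q' - q) * n ≤ lT' * esum (q' - q) * (max ‖u - u'‖ cd + t) :=
            mul_le_mul_of_nonneg_left h1 h3
        _ = lT' * esum (q' - q) * (max ‖u - u'‖ cd + t) * 1 := (mul_one _).symm
        _ ≤ lT' * esum (q' - q) * (max ‖u - u'‖ cd + t) * (1 + t) := by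
            apply mul_le_mul_of_nonneg_left (by linarith) (by positivity)
    have h := weakNormLE_of_bilinear_limit hPA (mul_nonneg hlT'0 hes0) hA0 zero_le_one
      (by positivity : 0 < P.r / 8) hlim
    rw [mul_one] at h
    exact h

/-- **The shrunk-package form of the `F4l'` half of the child `F4StatementOfCores`**: given the `N`-free two-kernel
bound `TwoKernelSkBound d` (the child's own hypothesis), every package admits an `N`-FREE size `l_T' ≥ 0` with
`F4l' P.shrink Q l_T'` at every height. -/
theorem f4l'_shrink_of_twoKernelSkBound (hTK : TwoKernelSkBound d) (P : PackageData d) [Fact (0 < P.h)]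
    [Fact (0 < P.L)] :
    ∃ lT' : ℝ, 0 ≤ lT' ∧ ∀ (N M : ℕ) [NeZero M] (Q : PackageAt P.shrink N M), F4l' P.shrink Q lT' := by
  obtain ⟨lT, hlT0, hl⟩ := hTK P
  exact ⟨((P.r₀ : ℝ) + 1) * (16 / 7) * lT, by positivity, fun N M _ Q => f4l'_shrink_of_f4l P Q hlT0 (hl N M Q.unshrink)⟩

end Summit.HubbardSuperconductivity.HubbardSuperconductivity.Theorems.ComplexGFF

end
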